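import Literature.Analysis.FluidPDE.EyinkBalanceLimits
import Literature.Analysis.FunctionSpaces.TorusTrigPoly
import HarnessLib

/-!
# Uniform Eyink defects of weak Euler solutions from Eyink's balance facts; the local 4/5 law

Topic: Analysis/FluidPDE, the assembly of the decomposition of the accepted fact
`Torus.HasDuchonRobertDefect.hasFourFifthsLaw` (`DissipationAnomaly`) along Eyink 2003, §2:

* the two scale-`ε` balance equations (uuL-eq), (uuT-eq) — named facts
  `Torus.eyink_longitudinal_balance`, `Torus.eyink_transverse_balance` (`EyinkBalance`);
* the convergence of their left-hand sides `𝓔_X^{ε,φ}(ψ) → c_X⁻¹ D(u,p)(ψ)`, **uniformly over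
  spherically symmetric unit-ball mollifiers** — proved (`EyinkBalanceLimits`:
  `Torus.eyinkBalanceL_sub_lt`, `Torus.eyinkBalanceT_sub_lt`);
* the `L^{3/2}` pressure of an `L³` weak Euler solution — named fact
  `Torus.exists_pressure_of_tendsto_L3` (`DuchonRobertInviscidLimit`, Calderón–Zygmund);
* uniform Eyink defect ⇒ unconditional local 4/5 and 8/15 laws — proved (`EyinkUniformDefect`,
  `EyinkUniformDefectConsistency`: `Torus.hasFourFifthsLaw_of_forall_hasUniformEyinkDefect`).

Proved here:

* `Torus.energyFluxFunctional T u p` — the defect functional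
  `D(u,p)(ψ) = ∫₀ᵀ∫ ½|u|²∂ₜψ + (½|u|² + p)⟪u,∇ψ⟫` of Duchon–Robert's local energy balance for Euler
  (`hasLocalEnergyBalance_energyFluxFunctional`: `Torus.HasLocalEnergyBalance T 0 u p G (D(u,p))` by
  definition);
* `Torus.hasUniformEyinkDefect_of_eyinkBalance` — **Eyink's Thm. 1 made uniform**: granted the two
  balance facts, every distributional Euler solution `(u,p)` on `T^d × (0,T)`, `d ≥ 2`, with
  `u ∈ L³_{t,x}`, `p ∈ L^{3/2}_{t,x}` has `D(u,p)` as a uniform Eyink defect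
  (`∫∫ D_X^{ε,φ} ψ = c_X 𝓔_X^{ε,φ}(ψ)` by the facts, `|𝓔_X − c_X⁻¹D(u,p)(ψ)| < c_X⁻¹η` uniformly);
  `hasUniformEyinkDefect_of_nonpos` (the degenerate `T ≤ 0`);
* `Torus.exists_hasUniformEyinkDefect_of_facts` and the conditional form of the accepted fact in
  dimension `d ≥ 2`, `Torus.hasFourFifthsLaw_of_eyinkBalance_facts_of_two_le`, with the companion
  8/15-type law `Torus.tendsto_mixedFlux_of_eyinkBalance_facts`;
* the degenerate dimensions: `Torus.hasFourFifthsLaw_of_isEmpty` (`d` empty: both sides vanish by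
  the junk conventions) and `Torus.hasFourFifthsLaw_of_card_eq_one` (**unconditional**: on `T¹` a
  weak Euler solution is weakly divergence free, hence a.e. constant in space at a.e. time —
  `IsWeaklyDivFree.ae_eq_const_of_card_eq_one`, by `IsWeaklyDivFree.sum_mul_mFourierCoeff_eq_zero`
  and Parseval — so all increments vanish a.e., the shell pairings vanish identically and the
  Duchon–Robert defect is zero);
* **the conditional form of the accepted fact in every dimension**:
  `Torus.hasFourFifthsLaw_of_eyinkBalance_facts :
  eyink_longitudinal_balance → eyink_transverse_balance → exists_pressure_of_tendsto_L3 →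
  HasDuchonRobertDefect.hasFourFifthsLaw`.

So the trust base of `HasDuchonRobertDefect.hasFourFifthsLaw` is reduced to the three named facts
above; its discharge (`…_holds`) awaits theirs (the matrix-kernel form of Duchon–Robert's
computation for the two balances; the Calderón–Zygmund pressure on `T^d`).

## References

* G. L. Eyink, *Local 4/5-law and energy dissipation anomaly in turbulence*, Nonlinearity 16
  (2003) 137–145 = arXiv:nlin/0208004: §2, Thm. 1 and its proof ((uuL-eq), (uuT-eq), "by the
  result of Duchon–Robert that quantity in the brackets is equal to minus the defect distribution
  `D(u)`. We conclude then that `D_X^ε(u) → D(u)`"), Cor. 1. [Eyink2003]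
* J. Duchon, R. Robert, Nonlinearity 13 (2000) 249–255: Prop. 1 (pressure), Prop. 2 (the defect
  and the local energy balance). [DuchonRobert2000]
* J. C. Robinson, J. L. Rodrigo, W. Sadowski, *The Three-Dimensional Navier–Stokes Equations*
  (CUP 2016), Lemma 5.1 and Prop. 5.3 (the `L^{3/2}` pressure). [RobinsonRodrigoSadowski2016]
* M. Novack, Nonlinearity 37 (2024) 095002, Thm. 1 (the unconditional laws, `d ≥ 2`). [Novack2024]
-/

noncomputable section

open MeasureTheory MeasureTheory.Measure TopologicalSpace Set Function Filter Topology Metric Module UnitAddTorus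
open scoped InnerProductSpace RealInnerProductSpace ENNReal NNReal

namespace Literature.Analysis.FluidPDE.Torus

variable {d : Type*} [Fintype d]

/-! ## From Eyink's balance facts to the uniform Eyink defect and the local 4/5 law -/

section Assembly

variable {T : ℝ} {u : ℝ → UnitAddTorus d → EuclideanSpace ℝ d} {p : ℝ → UnitAddTorus d → ℝ}

variable (T u p) in
/-- **The local energy flux functional** of a velocity/pressure pair:
`D(u,p)(ψ) = ∫₀ᵀ∫ ½|u|²∂ₜψ + (½|u|² + p)⟪u, ∇ψ⟫`, i.e. `−⟨∂ₜ(½|u|²) + ∇·[(½|u|²+p)u], ψ⟩` — the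
defect `D(u)` of Duchon–Robert's local energy balance for Euler (Duchon–Robert 2000, Prop. 2;
`Torus.HasLocalEnergyBalance T 0 u p G (energyFluxFunctional T u p)` holds by definition,
`hasLocalEnergyBalance_energyFluxFunctional`). [cite: DuchonRobert2000, Prop. 2] -/
def energyFluxFunctional : STFunctional d := fun ψ =>
  ∫ t in Ioo 0 T, ∫ x, (2⁻¹ * ‖u t x‖ ^ 2 * FunctionSpaces.Torus.timeDeriv ψ t x +
    (2⁻¹ * ‖u t x‖ ^ 2 + p t x) * ⟪u t x, FunctionSpaces.Torus.gradient (ψ t) x⟫)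

/-- Unfolding `energyFluxFunctional`. [folklore] -/
theorem energyFluxFunctional_apply (ψ : ℝ → UnitAddTorus d → ℝ) :
    energyFluxFunctional T u p ψ = ∫ t in Ioo 0 T, ∫ x, (2⁻¹ * ‖u t x‖ ^ 2 * FunctionSpaces.Torus.timeDeriv ψ t x +
      (2⁻¹ * ‖u t x‖ ^ 2 + p t x) * ⟪u t x, FunctionSpaces.Torus.gradient (ψ t) x⟫) :=
  rfl

/-- The local energy balance for Euler holds, by definition, with the energy flux functional as
defect (any `G`; the viscous terms vanish for `ν = 0`). [folklore] -/
theorem hasLocalEnergyBalance_energyFluxFunctional [DecidableEq d]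
    (G : ℝ → UnitAddTorus d → EuclideanSpace ℝ d →L[ℝ] EuclideanSpace ℝ d) :
    HasLocalEnergyBalance T 0 u p G (energyFluxFunctional T u p) := by
  refine ⟨fun h => absurd rfl h, fun ψ _ => ?_⟩
  rw [energyFluxFunctional_apply]
  refine setIntegral_congr_fun measurableSet_Ioo fun t _ => integral_congr_ae (ae_of_all _ fun x => ?_)
  simp only [mul_zero, zero_mul, add_zero, sub_zero]

/-- The spatial gradient of the zero function vanishes (local copy of the tree's
`Torus.torusGradient_zero`). [folklore] -/
private theorem torusGradient_zero_apply' (x : UnitAddTorus d) :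
    FunctionSpaces.Torus.gradient (0 : UnitAddTorus d → ℝ) x = 0 := by
  have : FunctionSpaces.Torus.liftAt (0 : UnitAddTorus d → ℝ) x = Function.const _ (0 : ℝ) := by
    funext v; rfl
  rw [FunctionSpaces.Torus.gradient, this, gradient_const]

/-- For `T ≤ 0` every functional is a uniform Eyink defect (test functions supported in `(0,T)`
vanish identically, so do all pairings; the zero functional works). [folklore] -/
theorem hasUniformEyinkDefect_of_nonpos (hT : T ≤ 0) : HasUniformEyinkDefect T u (energyFluxFunctional T u p) := by
  intro ψ hψ
  have hz : ∀ t x, ψ t x = 0 := fun t x => by rw [hψ.eq_zero_of_nonpos hT t]; rfl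
  have hD : energyFluxFunctional T u p ψ = 0 := by
    rw [energyFluxFunctional_apply]
    have h1 : ∀ t x, FunctionSpaces.Torus.timeDeriv ψ t x = 0 := fun t x => by
      have : ψ = fun _ _ => (0 : ℝ) := by funext t x; exact hz t x
      rw [this]; simp [FunctionSpaces.Torus.timeDeriv]
    have h2 : ∀ t, FunctionSpaces.Torus.gradient (ψ t) = 0 := fun t => by
      funext x
      have : ψ t = 0 := hψ.eq_zero_of_nonpos hT t
      rw [this, torusGradient_zero_apply']; rfl
    simp [h1, h2]
  constructor <;>
  · refine Metric.tendstoUniformlyOn_iff.2 fun η hη => Eventually.of_forall fun ε φ _ => ?_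
    simp [hz, hD, hη]

/-- **A single `L³` weak Euler solution has an `L^{3/2}` pressure** (the sequential fact
`Torus.exists_pressure_of_tendsto_L3` — Duchon–Robert 2000, Prop. 1; Robinson–Rodrigo–Sadowski 2016,
Lemma 5.1 and Prop. 5.3 — applied to a constant sequence; cf. the tree's
`IsWeakEulerSolutionOn.exists_pressure_of_fact`, re-derived here to keep the imports small). [cite: RobinsonRodrigoSadowski2016, Lemma 5.1 and Prop. 5.3] -/
theorem exists_pressure_of_fact' [DecidableEq d] (hA1 : exists_pressure_of_tendsto_L3 (T := T) (u := u))
    (hE : FunctionSpaces.Torus.IsWeakEulerSolutionOn T u) (hu3 : ∫⁻ t in Ioo 0 T, ∫⁻ x, ‖u t x‖ₑ ^ (3 : ℕ) < ∞) :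
    ∃ p : ℝ → UnitAddTorus d → ℝ, IsDistributionalNSSolutionOn T 0 0 u p ∧
      ∫⁻ t in Ioo 0 T, ∫⁻ x, ‖p t x‖ₑ ^ (3 / 2 : ℝ) < ∞ := by
  have hconv : Tendsto (fun _ : ℕ => ∫⁻ t in Ioo 0 T, ∫⁻ x, ‖u t x - u t x‖ₑ ^ (3 : ℕ)) atTop (𝓝 0) := by
    simp only [sub_self, enorm_zero, ne_eq, OfNat.ofNat_ne_zero, not_false_eq_true, zero_pow,
      lintegral_const, zero_mul]
    exact tendsto_const_nhds
  obtain ⟨-, p, -, hdist, hp32, -⟩ := hA1 (νseq := fun _ => 0) (ν := 0) (useq := fun _ => u)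
    (Eventually.of_forall fun _ => hE) hE hconv hu3
  exact ⟨p, hdist, hp32⟩

/-- **Eyink's Theorem 1, uniformly in the mollifier, from the two balance facts.** Granted the
scale-`ε` balances `eyink_longitudinal_balance`, `eyink_transverse_balance` (Eyink 2003, (uuL-eq),
(uuT-eq)), every distributional Euler solution `(u, p)` on `T^d × (0,T)` (`d ≥ 2`) with
`u ∈ L³_{t,x}`, `p ∈ L^{3/2}_{t,x}` has the energy flux functional as a **uniform Eyink defect**:
`∫∫ D_L^{ε,φ}(u) ψ → D(u,p)(ψ)` and `∫∫ D_T^{ε,φ}(u) ψ → D(u,p)(ψ)` uniformly over spherically symmetric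
unit-ball mollifiers (`∫∫ D_X^{ε,φ} ψ = c_X 𝓔_X^{ε,φ}(ψ)` by the facts, and `𝓔_X^{ε,φ}(ψ) → c_X⁻¹ D(u,p)(ψ)`
uniformly by `eyinkBalanceL_sub_lt` / `eyinkBalanceT_sub_lt`). [cite: Eyink2003, §2 Thm. 1] -/
theorem hasUniformEyinkDefect_of_eyinkBalance [DecidableEq d] (hL : eyink_longitudinal_balance (d := d))
    (hTr : eyink_transverse_balance (d := d)) (hd : 2 ≤ Fintype.card d)
    (hsol : IsDistributionalNSSolutionOn T 0 0 u p) (hu3 : ∫⁻ t in Ioo 0 T, ∫⁻ x, ‖u t x‖ₑ ^ (3 : ℕ) < ∞)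
    (hp32 : ∫⁻ t in Ioo 0 T, ∫⁻ x, ‖p t x‖ₑ ^ (3 / 2 : ℝ) < ∞) :
    HasUniformEyinkDefect T u (energyFluxFunctional T u p) := by
  haveI : Nonempty d := by
    by_contra h
    rw [not_nonempty_iff] at h
    have : Fintype.card d = 0 := Fintype.card_eq_zero
    omega
  have hn : (0 : ℝ) < Fintype.card d := by exact_mod_cast (show 0 < Fintype.card d by omega)
  have hn1 : (0 : ℝ) < (Fintype.card d : ℝ) - 1 := by
    have : (2 : ℝ) ≤ Fintype.card d := by exact_mod_cast hd
    linarith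
  refine hasUniformEyinkDefect_of_forall_exists fun ψ hψ η hη => ?_
  -- the two uniform limits of the balance pairings, at the scaled tolerances
  obtain ⟨εL, hεL, hLlim⟩ := eyinkBalanceL_sub_lt (T := T) (u := u) (p := p) hsol.1 hu3 hsol.2.2.1 hp32 hψ
    (η := 4 / Fintype.card d * η) (by positivity)
  obtain ⟨εT, hεT, hTlim⟩ := eyinkBalanceT_sub_lt (T := T) (u := u) (p := p) hsol.1 hu3 hsol.2.2.1 hp32 hψ
    (η := 4 * ((Fintype.card d : ℝ) - 1) / Fintype.card d * η) (by positivity)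
  refine ⟨min εL εT, lt_min hεL hεT, fun φ hφ ε hε => ⟨?_, ?_⟩⟩
  · have hid := hL hd hsol hu3 hp32 hφ.1.1 hφ.2 hε.1 hψ
    have hb := hLlim φ hφ.1 hφ.2 ε ⟨hε.1, hε.2.trans_le (min_le_left _ _)⟩
    rw [energyFluxFunctional_apply]
    -- `∫∫ D_L ψ = (d/4) 𝓔_L`
    have e : (∫ t in Ioo 0 T, ∫ x, eyinkLongitudinalApprox φ ε (u t) x * ψ t x) =
        (Fintype.card d : ℝ) / 4 * eyinkBalanceL T u p φ ε ψ := by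
      rw [hid]; field_simp
    rw [e]
    set I := ∫ t in Ioo 0 T, ∫ x, (2⁻¹ * ‖u t x‖ ^ 2 * FunctionSpaces.Torus.timeDeriv ψ t x +
      (2⁻¹ * ‖u t x‖ ^ 2 + p t x) * ⟪u t x, FunctionSpaces.Torus.gradient (ψ t) x⟫) with hI
    set B := eyinkBalanceL T u p φ ε ψ with hB
    have hc : 0 < (Fintype.card d : ℝ) / 4 := by positivity
    have hck : (Fintype.card d : ℝ) / 4 * (4 / Fintype.card d) = 1 := by field_simp
    have e2 : (Fintype.card d : ℝ) / 4 * B - I = (Fintype.card d : ℝ) / 4 * (B - 4 / Fintype.card d * I) := by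
      linear_combination I * hck
    rw [e2, abs_mul, abs_of_pos hc]
    calc (Fintype.card d : ℝ) / 4 * |B - 4 / Fintype.card d * I| < (Fintype.card d : ℝ) / 4 * (4 / Fintype.card d * η) := by
          gcongr
      _ = η := by field_simp
  · have hid := hTr hd hsol hu3 hp32 hφ.1.1 hφ.2 hε.1 hψ
    have hb := hTlim φ hφ.1 hφ.2 ε ⟨hε.1, hε.2.trans_le (min_le_right _ _)⟩
    rw [energyFluxFunctional_apply]
    have e : (∫ t in Ioo 0 T, ∫ x, eyinkTransverseApprox φ ε (u t) x * ψ t x) =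
        (Fintype.card d : ℝ) / (4 * ((Fintype.card d : ℝ) - 1)) * eyinkBalanceT T u p φ ε ψ := by
      rw [hid]; field_simp
    rw [e]
    set I := ∫ t in Ioo 0 T, ∫ x, (2⁻¹ * ‖u t x‖ ^ 2 * FunctionSpaces.Torus.timeDeriv ψ t x +
      (2⁻¹ * ‖u t x‖ ^ 2 + p t x) * ⟪u t x, FunctionSpaces.Torus.gradient (ψ t) x⟫) with hI
    set B := eyinkBalanceT T u p φ ε ψ with hB
    have hc : 0 < (Fintype.card d : ℝ) / (4 * ((Fintype.card d : ℝ) - 1)) := by positivity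
    have hck : (Fintype.card d : ℝ) / (4 * ((Fintype.card d : ℝ) - 1)) * (4 * ((Fintype.card d : ℝ) - 1) / Fintype.card d) = 1 := by
      field_simp
    have e2 : (Fintype.card d : ℝ) / (4 * ((Fintype.card d : ℝ) - 1)) * B - I =
        (Fintype.card d : ℝ) / (4 * ((Fintype.card d : ℝ) - 1)) * (B - 4 * ((Fintype.card d : ℝ) - 1) / Fintype.card d * I) := by
      linear_combination I * hck
    rw [e2, abs_mul, abs_of_pos hc]
    calc (Fintype.card d : ℝ) / (4 * ((Fintype.card d : ℝ) - 1)) * |B - 4 * ((Fintype.card d : ℝ) - 1) / Fintype.card d * I|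
        < (Fintype.card d : ℝ) / (4 * ((Fintype.card d : ℝ) - 1)) * (4 * ((Fintype.card d : ℝ) - 1) / Fintype.card d * η) := by
          gcongr
      _ = η := by field_simp

/-- **Every `L³` weak Euler solution with a Duchon–Robert defect has a uniform Eyink defect**
(`d ≥ 2`), granted the two balance facts and the `L^{3/2}` pressure fact
`Torus.exists_pressure_of_tendsto_L3`: the hypothesis of
`Torus.hasFourFifthsLaw_of_forall_hasUniformEyinkDefect`. [folklore] -/
theorem exists_hasUniformEyinkDefect_of_facts [DecidableEq d] (hL : eyink_longitudinal_balance (d := d))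
    (hTr : eyink_transverse_balance (d := d)) (hA1 : exists_pressure_of_tendsto_L3 (T := T) (u := u))
    (hd : 2 ≤ Fintype.card d) (hE : FunctionSpaces.Torus.IsWeakEulerSolutionOn T u)
    (hu3 : ∫⁻ t in Ioo 0 T, ∫⁻ x, ‖u t x‖ₑ ^ (3 : ℕ) < ∞) :
    ∃ D' : STFunctional d, HasUniformEyinkDefect T u D' := by
  obtain ⟨p, hsol, hp32⟩ := exists_pressure_of_fact' hA1 hE hu3
  exact ⟨energyFluxFunctional T u p, hasUniformEyinkDefect_of_eyinkBalance hL hTr hd hsol hu3 hp32⟩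

/-- In dimension zero the sphere-averaged third-order longitudinal structure function vanishes
identically (empty unit sphere; Mathlib's average over the zero measure is `0`). [folklore] -/
theorem longitudinalFluxSphereAvg_of_isEmpty [IsEmpty d] (w : UnitAddTorus d → EuclideanSpace ℝ d) (ℓ : ℝ)
    (x : UnitAddTorus d) : longitudinalFluxSphereAvg w ℓ x = 0 := by
  have hE : IsEmpty ↥(sphere (0 : EuclideanSpace ℝ d) 1) := by
    refine ⟨fun ω => ?_⟩
    have h1 : ‖(ω : EuclideanSpace ℝ d)‖ = 1 := norm_eq_of_mem_sphere ω
    have h0 : ‖(ω : EuclideanSpace ℝ d)‖ = 0 := by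
      rw [EuclideanSpace.norm_eq]
      simp
    linarith
  have hσ : (volume : Measure (EuclideanSpace ℝ d)).toSphere = 0 := Measure.eq_zero_of_isEmpty _
  simp [longitudinalFluxSphereAvg, sphereAvg, hσ]

/-- **The accepted fact in dimension zero** (degenerate: both sides of the 4/5 law vanish,
`fourFifthsConst d = 12/0 = 0`). [folklore] -/
theorem hasFourFifthsLaw_of_isEmpty [IsEmpty d] : HasDuchonRobertDefect.hasFourFifthsLaw (T := T) (u := u) := by
  intro _ D _ _ _ ψ _
  have hc0 : fourFifthsConst d = 0 := by simp [fourFifthsConst, Fintype.card_eq_zero]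
  simp only [longitudinalFluxSphereAvg_of_isEmpty, mul_zero, zero_mul, integral_zero, hc0, neg_zero]
  exact tendsto_const_nhds

/-- **The accepted fact `HasDuchonRobertDefect.hasFourFifthsLaw` in dimension `d ≥ 2`, from the
three named facts** `eyink_longitudinal_balance`, `eyink_transverse_balance` (Eyink 2003, (uuL-eq),
(uuT-eq)) and `exists_pressure_of_tendsto_L3` (the Calderón–Zygmund pressure): for every `L³` weak
Euler solution `u` on `T^d × (0,T)` with Duchon–Robert defect `D`, the local 4/5 law
`Torus.HasFourFifthsLaw T u D` holds — with the existence of the shell limit as a conclusion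
(Eyink 2003, Thm. 1 + Cor. 1 made unconditional; Novack 2024, Thm. 1). [cite: Eyink2003, §2 Thm. 1 and Cor. 1] -/
theorem hasFourFifthsLaw_of_eyinkBalance_facts_of_two_le [instD : DecidableEq d] (hL : eyink_longitudinal_balance (d := d))
    (hTr : eyink_transverse_balance (d := d)) (hA1 : exists_pressure_of_tendsto_L3 (T := T) (u := u))
    (hd : 2 ≤ Fintype.card d) :
    HasDuchonRobertDefect.hasFourFifthsLaw (T := T) (u := u) := by
  intro instD' D h hE hu3
  have e : instD' = instD := Subsingleton.elim _ _
  subst e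
  obtain ⟨D', hD'⟩ := exists_hasUniformEyinkDefect_of_facts hL hTr hA1 hd hE hu3
  exact h.hasFourFifthsLaw_of_hasUniformEyinkDefect hD' hd hE.1 hu3

/-- The companion transverse law under the same facts: the mixed shell pairing converges,
`∫₀ᵀ∫ ℓ⁻¹⟨δu_L|δu_T|²⟩_{ang}(ℓ) ψ → −(4(d−1)/(d(d+2))) D ψ` (`−(8/15) D ψ` in `d = 3`, Eyink 2003,
Cor. 1, unconditional). [cite: Eyink2003, §2 Cor. 1] -/
theorem tendsto_mixedFlux_of_eyinkBalance_facts [DecidableEq d] (hL : eyink_longitudinal_balance (d := d))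
    (hTr : eyink_transverse_balance (d := d)) (hA1 : exists_pressure_of_tendsto_L3 (T := T) (u := u))
    (hd : 2 ≤ Fintype.card d) {D : STFunctional d} (h : HasDuchonRobertDefect T u D)
    (hE : FunctionSpaces.Torus.IsWeakEulerSolutionOn T u) (hu3 : ∫⁻ t in Ioo 0 T, ∫⁻ x, ‖u t x‖ₑ ^ (3 : ℕ) < ∞)
    {ψ : ℝ → UnitAddTorus d → ℝ} (hψ : FunctionSpaces.Torus.IsSpaceTimeTestIoo T ψ) :
    Tendsto (fun ℓ => ∫ t in Ioo 0 T, ∫ x, ℓ⁻¹ * mixedFluxSphereAvg (u t) ℓ x * ψ t x) (𝓝[>] 0)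
      (𝓝 (-(4 * ((Fintype.card d : ℝ) - 1) /
        ((Fintype.card d : ℝ) * ((Fintype.card d : ℝ) + 2))) * D ψ)) := by
  obtain ⟨D', hD'⟩ := exists_hasUniformEyinkDefect_of_facts hL hTr hA1 hd hE hu3
  exact h.tendsto_mixedFlux_of_hasUniformEyinkDefect hD' hd hE.1 hu3 hψ

end Assembly

/-! ## One space dimension: weakly divergence-free fields are constant -/

section DimOne

/-- In one space dimension the non-constant Fourier modes of a weakly divergence-free `L²` field
vanish: `k û(k) = 0` (`IsWeaklyDivFree.sum_mul_mFourierCoeff_eq_zero`, a one-term sum) forces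
`û(k) = 0` for `k ≠ 0`. [folklore] -/
theorem _root_.Literature.Analysis.FunctionSpaces.Torus.IsWeaklyDivFree.mFourierCoeff_eq_zero_of_card_eq_one
    [DecidableEq d] (hd : Fintype.card d = 1) {v : UnitAddTorus d → EuclideanSpace ℝ d}
    (hv : MemLp v 2 volume) (hdiv : FunctionSpaces.Torus.IsWeaklyDivFree v) {k : d → ℤ} (hk : k ≠ 0) :
    mFourierCoeff (FunctionSpaces.EuclideanSpace.complexify ∘ v) k = 0 := by
  haveI : Subsingleton d := Fintype.card_le_one_iff_subsingleton.mp hd.le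
  obtain ⟨j₀, hj₀⟩ : ∃ j, k j ≠ 0 := Function.ne_iff.mp hk
  have h := hdiv.sum_mul_mFourierCoeff_eq_zero hv k
  rw [Fintype.sum_subsingleton _ j₀] at h
  have hj : mFourierCoeff (FunctionSpaces.EuclideanSpace.complexify ∘ v) k j₀ = 0 :=
    (mul_eq_zero.mp h).resolve_left (by exact_mod_cast hj₀)
  ext j
  obtain rfl : j = j₀ := Subsingleton.elim j j₀
  simpa using hj

/-- Fourier coefficients of a constant vector field: `𝓕(c)(k) = δ_{k0} c`. [folklore] -/
theorem mFourierCoeff_complexify_const (c : EuclideanSpace ℝ d) (k : d → ℤ) :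
    mFourierCoeff (FunctionSpaces.EuclideanSpace.complexify ∘ fun _ : UnitAddTorus d => c) k =
      (if k = 0 then (1 : ℂ) else 0) • FunctionSpaces.EuclideanSpace.complexify c := by
  rw [FunctionSpaces.Torus.mFourierCoeff_eq_integral_volume]
  simp only [comp_apply]
  rw [integral_smul_const, FunctionSpaces.Torus.integral_mFourier]
  simp only [neg_eq_zero]

/-- The zero Fourier mode of an integrable vector field is its mean. [folklore] -/
theorem mFourierCoeff_complexify_zero_eq_integral {v : UnitAddTorus d → EuclideanSpace ℝ d} :
    mFourierCoeff (FunctionSpaces.EuclideanSpace.complexify ∘ v) 0 = FunctionSpaces.EuclideanSpace.complexify (∫ x, v x) := by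
  rw [FunctionSpaces.Torus.mFourierCoeff_eq_integral_volume]
  simp only [neg_zero, mFourier_zero, ContinuousMap.one_apply, one_smul, comp_apply]
  exact FunctionSpaces.EuclideanSpace.complexify.integral_comp_comm v

/-- **Weakly divergence-free `L²` fields on the one-dimensional torus are a.e. constant**
(`∂ₓv = 0` in `𝒟'(T¹)`): all Fourier modes of `v − ⨍v` vanish
(`mFourierCoeff_eq_zero_of_card_eq_one` off `k = 0`, the mean at `k = 0`), so `∫ ‖v − ⨍v‖² = 0`
by Parseval (`hasSum_sq_norm_mFourierCoeff_complexify`). [folklore] -/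
theorem _root_.Literature.Analysis.FunctionSpaces.Torus.IsWeaklyDivFree.ae_eq_const_of_card_eq_one
    [DecidableEq d] (hd : Fintype.card d = 1) {v : UnitAddTorus d → EuclideanSpace ℝ d}
    (hv : MemLp v 2 volume) (hdiv : FunctionSpaces.Torus.IsWeaklyDivFree v) :
    v =ᵐ[volume] fun _ => ∫ x, v x := by
  set c : EuclideanSpace ℝ d := ∫ x, v x with hc
  have hvi : Integrable v volume := hv.integrable one_le_two
  have hw : MemLp (fun x => v x - c) 2 volume := hv.sub (memLp_const c)
  -- all Fourier coefficients of `v - c` vanish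
  have hcoef : ∀ k, mFourierCoeff (FunctionSpaces.EuclideanSpace.complexify ∘ fun x => v x - c) k = 0 := by
    intro k
    have hsplit : mFourierCoeff (FunctionSpaces.EuclideanSpace.complexify ∘ fun x => v x - c) k =
        mFourierCoeff (FunctionSpaces.EuclideanSpace.complexify ∘ v) k -
          mFourierCoeff (FunctionSpaces.EuclideanSpace.complexify ∘ fun _ : UnitAddTorus d => c) k := by
      have h := FunctionSpaces.Torus.mFourierCoeff_sub
        (FunctionSpaces.Torus.integrable_complexify_comp hvi)
        (FunctionSpaces.Torus.integrable_complexify_comp (integrable_const c)) k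
      rw [← FunctionSpaces.Torus.complexify_comp_sub] at h
      exact h
    by_cases hk : k = 0
    · subst hk
      rw [hsplit, mFourierCoeff_complexify_zero_eq_integral, mFourierCoeff_complexify_const, if_pos rfl,
        one_smul, sub_self]
    · rw [hsplit, hdiv.mFourierCoeff_eq_zero_of_card_eq_one hd hv hk, mFourierCoeff_complexify_const,
        if_neg hk, zero_smul, sub_zero]
  -- Parseval
  have hP := FunctionSpaces.Torus.hasSum_sq_norm_mFourierCoeff_complexify hw
  simp only [hcoef, norm_zero, ne_eq, OfNat.ofNat_ne_zero, not_false_eq_true, zero_pow] at hP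
  have hint0 : ∫ x, ‖v x - c‖ ^ 2 = 0 := hP.unique hasSum_zero
  have hI : Integrable (fun x => ‖v x - c‖ ^ 2) volume := hw.integrable_norm_pow two_ne_zero
  have hae := (integral_eq_zero_iff_of_nonneg_ae (ae_of_all _ fun x => sq_nonneg ‖v x - c‖) hI).mp hint0
  filter_upwards [hae] with x hx
  have hx' : ‖v x - c‖ = 0 := pow_eq_zero_iff two_ne_zero |>.mp hx
  exact sub_eq_zero.mp (norm_eq_zero.mp hx')

/-! ### Increments of a.e.-constant fields -/

variable {F : Type*} [NormedAddCommGroup F]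

/-- Increments of an a.e.-constant field vanish a.e. **jointly** in the base point and in any
measurable family of separations (translation invariance of Haar measure on `T^d`, through the
quasi-measure-preserving shear `(x, b) ↦ x + π s(b)`). [folklore] -/
theorem increment_ae_eq_zero_of_ae_eq_const {β : Type*} [MeasurableSpace β] {ν : Measure β} [SFinite ν]
    {v : UnitAddTorus d → F} {c : F} (hv : v =ᵐ[volume] fun _ => c)
    {s : β → EuclideanSpace ℝ d} (hs : Measurable s) :
    ∀ᵐ q ∂((volume : Measure (UnitAddTorus d)).prod ν), increment v (s q.2) q.1 = 0 := by
  have hqmp : QuasiMeasurePreserving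
      (fun q : UnitAddTorus d × β => q.1 + FunctionSpaces.Torus.proj (s q.2)) (volume.prod ν) volume := by
    refine QuasiMeasurePreserving.prod_of_left
      (measurable_fst.add ((FunctionSpaces.Torus.measurable_proj.comp hs).comp measurable_snd))
      (ae_of_all _ fun b => ?_)
    exact (measurePreserving_add_right volume (FunctionSpaces.Torus.proj (s b))).quasiMeasurePreserving
  have h1 := hqmp.ae_eq_comp hv
  have h2 := (quasiMeasurePreserving_fst (μ := (volume : Measure (UnitAddTorus d))) (ν := ν)).ae_eq_comp hv
  filter_upwards [h1, h2] with q h1 h2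
  simp only [comp_apply] at h1 h2
  rw [increment, h1, h2, sub_self]

/-- The sphere-averaged longitudinal structure function of an a.e.-constant field vanishes a.e. [folklore] -/
theorem longitudinalFluxSphereAvg_ae_eq_zero_of_ae_eq_const {v : UnitAddTorus d → EuclideanSpace ℝ d}
    {c : EuclideanSpace ℝ d} (hv : v =ᵐ[volume] fun _ => c) (ℓ : ℝ) :
    (fun x => longitudinalFluxSphereAvg v ℓ x) =ᵐ[volume] 0 := by
  have hs : Measurable fun ω : sphere (0 : EuclideanSpace ℝ d) 1 => ℓ • (ω : EuclideanSpace ℝ d) :=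
    (continuous_subtype_val.const_smul ℓ).measurable
  have h := increment_ae_eq_zero_of_ae_eq_const (ν := (volume : Measure (EuclideanSpace ℝ d)).toSphere) hv hs
  filter_upwards [Measure.ae_ae_of_ae_prod h] with x hx
  simp only [Pi.zero_apply, longitudinalFluxSphereAvg, sphereAvg]
  have h0 : (fun ω : sphere (0 : EuclideanSpace ℝ d) 1 =>
      ⟪increment v (ℓ • (ω : EuclideanSpace ℝ d)) x, (ω : EuclideanSpace ℝ d)⟫ ^ 3) =ᵐ[volume.toSphere]
      fun _ => (0 : ℝ) := by
    filter_upwards [hx] with ω hω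
    simp [hω]
  rw [average_congr h0, average_zero]

/-- The Duchon–Robert flux of an a.e.-constant field vanishes a.e. [folklore] -/
theorem duchonRobertApprox_ae_eq_zero_of_ae_eq_const {v : UnitAddTorus d → EuclideanSpace ℝ d}
    {c : EuclideanSpace ℝ d} (hv : v =ᵐ[volume] fun _ => c) (φ : EuclideanSpace ℝ d → ℝ) (ε : ℝ) :
    (fun x => duchonRobertApprox φ ε v x) =ᵐ[volume] 0 := by
  have h := increment_ae_eq_zero_of_ae_eq_const (ν := (volume : Measure (EuclideanSpace ℝ d))) hv
    measurable_id
  filter_upwards [Measure.ae_ae_of_ae_prod h] with x hx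
  simp only [Pi.zero_apply, duchonRobertApprox]
  rw [integral_congr_ae (g := fun _ => (0 : ℝ)), integral_zero, mul_zero]
  filter_upwards [hx] with ξ hξ
  simp only [id_eq] at hξ
  simp [hξ]

/-! ### Time slices of weak solutions -/

variable {T ν₀ : ℝ} {u : ℝ → UnitAddTorus d → EuclideanSpace ℝ d}

/-- Almost every time slice of a weak Navier–Stokes/Euler solution on `T^d × (0,T)` is an `L²`
field (Tonelli on the recorded `L²_{t,x}` bound and joint measurability). [folklore] -/
theorem _root_.Literature.Analysis.FunctionSpaces.Torus.IsWeakNSSolutionOn.ae_memLp_two [DecidableEq d]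
    (hE : FunctionSpaces.Torus.IsWeakNSSolutionOn T ν₀ u) :
    ∀ᵐ t ∂(volume.restrict (Ioo 0 T)), MemLp (u t) 2 volume := by
  have hu := aestronglyMeasurable_uncurry_prod_of_stLift_Ioo hE.1
  have h1 : ∀ᵐ t ∂(volume.restrict (Ioo 0 T)), AEStronglyMeasurable (u t) volume := hu.prodMk_left
  have h2m : AEMeasurable (fun t => ∫⁻ x, ‖u t x‖ₑ ^ 2) (volume.restrict (Ioo 0 T)) :=
    (hu.enorm.pow_const 2).lintegral_prod_right'
  have h2 : ∀ᵐ t ∂(volume.restrict (Ioo 0 T)), ∫⁻ x, ‖u t x‖ₑ ^ 2 < ∞ := ae_lt_top' h2m hE.2.1.ne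
  filter_upwards [h1, h2] with t h1 h2
  refine ⟨h1, ?_⟩
  rw [eLpNorm_lt_top_iff_lintegral_rpow_enorm_lt_top two_ne_zero ENNReal.ofNat_ne_top]
  simpa only [ENNReal.toReal_ofNat, ENNReal.rpow_ofNat] using h2

/-- **The accepted fact `HasDuchonRobertDefect.hasFourFifthsLaw` in one space dimension.** On
`T¹` a weak Euler solution is weakly divergence free, hence a.e. constant in space at a.e. time
(`IsWeaklyDivFree.ae_eq_const_of_card_eq_one`); all increments vanish a.e., so the shell pairings
`∫∫ ℓ⁻¹⨍(δu_L)³ψ` vanish identically and the Duchon–Robert defect is zero (`D ψ = lim ∫∫D_εψ = 0`):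
both sides of the local 4/5 law are zero. (The sources, Eyink 2003 / Duchon–Robert 2000, work in
`d = 3`; this degenerate case is recorded only because the tree's statement quantifies over all
finite index types `d`.) [folklore] -/
theorem hasFourFifthsLaw_of_card_eq_one (hd : Fintype.card d = 1) :
    HasDuchonRobertDefect.hasFourFifthsLaw (T := T) (u := u) := by
  intro _ D h hE _hu3 ψ hψ
  -- a.e. time slice is a.e. constant in space
  have hconst : ∀ᵐ t ∂(volume.restrict (Ioo 0 T)), u t =ᵐ[volume] fun _ => ∫ x, u t x := by
    filter_upwards [hE.ae_memLp_two, hE.2.2.1] with t h2 hdiv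
    exact hdiv.ae_eq_const_of_card_eq_one hd h2
  -- the shell pairings vanish identically
  have hS : ∀ ℓ : ℝ, ∫ t in Ioo 0 T, ∫ x, ℓ⁻¹ * longitudinalFluxSphereAvg (u t) ℓ x * ψ t x = 0 := by
    intro ℓ
    refine integral_eq_zero_of_ae ?_
    filter_upwards [hconst] with t ht
    refine integral_eq_zero_of_ae ?_
    filter_upwards [longitudinalFluxSphereAvg_ae_eq_zero_of_ae_eq_const ht ℓ] with x hx
    simp only [Pi.zero_apply] at hx
    simp [hx]
  -- the defect vanishes
  have hD : D ψ = 0 := by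
    obtain ⟨φ, hφ⟩ := exists_isMollifier (d := d)
    have h1 := h φ hφ ψ hψ
    have h0 : (fun ε => ∫ t in Ioo 0 T, ∫ x, duchonRobertApprox φ ε (u t) x * ψ t x) = fun _ => 0 := by
      funext ε
      refine integral_eq_zero_of_ae ?_
      filter_upwards [hconst] with t ht
      refine integral_eq_zero_of_ae ?_
      filter_upwards [duchonRobertApprox_ae_eq_zero_of_ae_eq_const ht φ ε] with x hx
      simp only [Pi.zero_apply] at hx
      simp [hx]
    rw [h0] at h1
    exact (tendsto_nhds_unique tendsto_const_nhds h1).symm ▸ rfl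
  simp only [hS, hD, mul_zero]
  exact tendsto_const_nhds

end DimOne

/-! ## The accepted fact from the three named facts, in every dimension -/

section AllDimensions

variable {T : ℝ} {u : ℝ → UnitAddTorus d → EuclideanSpace ℝ d}

/-- **The accepted fact `HasDuchonRobertDefect.hasFourFifthsLaw` from the three named facts**
`eyink_longitudinal_balance`, `eyink_transverse_balance` (Eyink 2003, §2, (uuL-eq)/(uuT-eq)) and
`exists_pressure_of_tendsto_L3` (the Calderón–Zygmund pressure), in every dimension: `d ≥ 2` is
`hasFourFifthsLaw_of_eyinkBalance_facts_of_two_le`; `d = 1` and `d = 0` hold unconditionally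
(`hasFourFifthsLaw_of_card_eq_one`, `hasFourFifthsLaw_of_isEmpty`). Feeding it the discharges of the
three facts will give `HasDuchonRobertDefect.hasFourFifthsLaw_holds`. [cite: Eyink2003, §2 Thm. 1 and Cor. 1] -/
theorem hasFourFifthsLaw_of_eyinkBalance_facts [instD : DecidableEq d] (hL : eyink_longitudinal_balance (d := d))
    (hTr : eyink_transverse_balance (d := d)) (hA1 : exists_pressure_of_tendsto_L3 (T := T) (u := u)) :
    HasDuchonRobertDefect.hasFourFifthsLaw (T := T) (u := u) := by
  intro instD' D h hE hu3
  have e : instD' = instD := Subsingleton.elim _ _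
  subst e
  rcases Nat.lt_or_ge (Fintype.card d) 2 with hlt | hge
  · rcases (by omega : Fintype.card d = 0 ∨ Fintype.card d = 1) with h0 | h1
    · haveI : IsEmpty d := Fintype.card_eq_zero_iff.mp h0
      exact hasFourFifthsLaw_of_isEmpty h hE hu3
    · exact hasFourFifthsLaw_of_card_eq_one h1 h hE hu3
  · exact hasFourFifthsLaw_of_eyinkBalance_facts_of_two_le hL hTr hA1 hge h hE hu3

end AllDimensions

end Literature.Analysis.FluidPDE.Torus
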